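import Summits.CriticalPhenomena.PercolationContinuityZ3.Theorems.TallClusterMassBound.Negative.MassExponentFamily

/-!
# `TallClusterMassBound` (stmt-CriticalPhenomena-0912), line `replica-overlap-cs-transfer` — the overlap sandwich

Helper lemmas for the registered stub `stub_topShellOverlap` of the line skeleton
`Cruxes/TallClusterMassBound/Lines/replica-overlap-cs-transfer.lean` (lead prover, cycle 1).

For any finite set `s` of vertices, any parameter `p` and any tallness `n`, with
`f(x) := P_p(0 ↔_ℍ x ∧ arm_ℍ(0,n))` and `π := P_p(arm_ℍ(0,n))`:

* `sum_sq_le_armProb_mul_sum` : `Σ_{x ∈ s} f(x)² ≤ π · Σ_{x ∈ s} f(x)` — the replica overlap on `s` is at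
  most `π_p(n)` times the conditional-mass numerator on `s` (termwise `f ≤ π`). Consequence for the line:
  the top-shell overlap stub (exponent `5/2` on `π²`) is IMPLIED by a top-shell mass bound with exponent
  `5/2` (on `π`), and by Cauchy–Schwarz it IMPLIES the top-shell mass bound with exponent `11/4`; the stub
  sits inside a window of width `1/4` around the crux's own exponent restricted to the top shell.
* `sum_sq_le_armProb_sq_mul_card` : the trivial bound `Σ_{x ∈ s} f(x)² ≤ #s · π²`.
-/

noncomputable section

open MeasureTheory Finset
open Literature.Probability.Percolation Literature.Probability.LatticeModels
open Summit.CriticalPhenomena.PercolationContinuityZ3.Theorems.TallClusterMassBound.Negative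

namespace Summit.CriticalPhenomena.PercolationContinuityZ3.Theorems.TallClusterMassBound.ReplicaOverlap

/-- **Overlap ≤ arm probability × mass** (upper half of the overlap sandwich): for every finite vertex set
`s`, `Σ_{x ∈ s} P_p(0 ↔_ℍ x, arm_n)² ≤ π_p(n) · Σ_{x ∈ s} P_p(0 ↔_ℍ x, arm_n)`, because each term is at most
`π_p(n)`. [folklore] -/
theorem sum_sq_le_armProb_mul_sum :
    ∀ (p : unitInterval) (n : ℕ) (s : Finset V3),
      ∑ x ∈ s, ((Pp p).real (conn x ∩ arm n)) ^ 2 ≤ armProb p n * ∑ x ∈ s, (Pp p).real (conn x ∩ arm n) := by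
  intro p n s
  rw [Finset.mul_sum]
  refine Finset.sum_le_sum fun x _ => ?_
  rw [sq]
  exact mul_le_mul_of_nonneg_right (real_conn_inter_arm_le p x n) measureReal_nonneg

/-- **Trivial overlap bound**: `Σ_{x ∈ s} P_p(0 ↔_ℍ x, arm_n)² ≤ #s · π_p(n)²`. [folklore] -/
theorem sum_sq_le_armProb_sq_mul_card (p : unitInterval) (n : ℕ) (s : Finset V3) :
    ∑ x ∈ s, ((Pp p).real (conn x ∩ arm n)) ^ 2 ≤ (#s : ℝ) * (armProb p n) ^ 2 := by
  calc ∑ x ∈ s, ((Pp p).real (conn x ∩ arm n)) ^ 2 ≤ ∑ _x ∈ s, (armProb p n) ^ 2 :=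
        Finset.sum_le_sum fun x _ =>
          pow_le_pow_left₀ measureReal_nonneg (real_conn_inter_arm_le p x n) 2
    _ = (#s : ℝ) * (armProb p n) ^ 2 := by rw [Finset.sum_const, nsmul_eq_mul]

end Summit.CriticalPhenomena.PercolationContinuityZ3.Theorems.TallClusterMassBound.ReplicaOverlap
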